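import Literature.NumberTheory.EllipticCurves.Curve5077aAnalyticRank
import Literature.NumberTheory.EllipticCurves.Curve5077aRootNumber
import HarnessLib

/-!
# The curve 5077a: `3 ≤ ord_{s=1} L(E,s)` from two named facts only

Assembly of the numerics-free half of the Buhler–Gross–Zagier / Goldfeld–Oesterlé order-3
certification for `E = 5077a : y² + y = x³ − 7x + 6` (BGZ 1985 p. 479 «Since L(s) has odd order,
we have ord_{s=1} L(s) ≥ 3»), from the tree files
`Curve5077aRank` (exact 2-descent certificate: `3 ≤ rank E(ℚ)`),
`Curve5077aRootNumber` (`algebraicRootNumber E = −1`: non-split multiplicative at `5077`, good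
elsewhere) and `Curve5077aAnalyticRank` (Kolyvagin contraposed + odd parity).

* `not_hasAdditiveReductionAt` — `5077a` is semistable (no additive place: `Δ = 5077`, `c₄ = 336`,
  `109·5077 − 1647·336 = 1`), so the additive-place proviso of the root-number fact is vacuous
  (`hadd`);
* `rootNumber_eq_neg_one (hRA)` — BGZ's sign `Λ(s) = −Λ(2−s)` ((10), p. 478) as a theorem about
  the model, under the named fact `rootNumber_eq_algebraicRootNumber` alone;
* `three_le_analyticRank_of_facts (hGZK) (hRA) : 3 ≤ E.analyticRank` — the inputs are EXACTLY the
  two named literature facts `rank_eq_analyticRank_of_analyticRank_le_one` (Gross–Zagier–Kolyvagin,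
  bsd.S17) and `rootNumber_eq_algebraicRootNumber` (Deligne–Rohrlich via modularity); everything
  curve-specific (three independent points, the reduction types, semistability) is PROVED;
* `analyticRank_eq_three_of_facts (hGZK) (hRA) (h3)` — adding the certified upper bound
  `ord ≤ 3` (`L‴(E,1) ≠ 0`, BGZ (14)) as hypothesis `h3`.

## References
* J. P. Buhler, B. H. Gross, D. B. Zagier, Math. Comp. 44 (1985) 473–481, (10) p. 478, p. 479,
  (14). [BuhlerGrossZagier1985]
* J. H. Silverman, *The Arithmetic of Elliptic Curves*, GTM 106, VII.5 Prop. 5.1. [SilvermanAEC2009]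
-/

open IsDedekindDomain WeierstrassCurve

namespace Literature.NumberTheory.EllipticCurves.Curve5077a

/-- **`5077a` is semistable**: no finite place of additive reduction (at `v ∤ 5077` the
discriminant `Δ = 5077` is a unit; at `v | 5077`, `c₄ = 336` is a unit since
`109·5077 − 1647·336 = 1`; Silverman AEC VII.5 Prop. 5.1). [cite: SilvermanAEC2009, VII.5 Prop. 5.1] -/
theorem not_hasAdditiveReductionAt (v : HeightOneSpectrum ℤ) : ¬ E.HasAdditiveReductionAt v := by
  rw [← WeierstrassCurve.isSemistableAt_iff_not_hasAdditiveReductionAt]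
  have hint := E_isIntegralAt v
  rcases (WeierstrassCurve.valuation_Δ_le_one_of_isIntegralAt hint).eq_or_lt with hΔ | hΔ
  · exact WeierstrassCurve.isSemistableAt_of_valuation_Δ_eq_one hint hΔ
  · apply WeierstrassCurve.isSemistableAt_of_valuation_c₄_eq_one hint
    rw [E_c₄]
    rw [E_Δ] at hΔ
    have hΔ' : v.valuation ℚ (algebraMap ℤ ℚ 5077) < 1 := by simpa using hΔ
    have h1 : (5077 : ℤ) ∈ v.asIdeal := (v.valuation_lt_one_iff_mem (5077 : ℤ)).mp hΔ'
    by_contra h2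
    have h2c : v.valuation ℚ (algebraMap ℤ ℚ 336) ≠ 1 := by simpa using h2
    have h336 : (336 : ℤ) ∈ v.asIdeal :=
      (v.valuation_lt_one_iff_mem (336 : ℤ)).mp (lt_of_le_of_ne (v.valuation_le_one (336 : ℤ)) h2c)
    have hone : (1 : ℤ) ∈ v.asIdeal := by
      have := v.asIdeal.add_mem (v.asIdeal.mul_mem_left 109 h1)
        (v.asIdeal.mul_mem_left (-1647) h336)
      convert this using 1
      norm_num
    exact v.isPrime.ne_top ((Ideal.eq_top_iff_one _).mpr hone)

/-- The additive-place proviso of `rootNumber_eq_algebraicRootNumber` is vacuous for `5077a`.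
[cite: SilvermanAEC2009, VII.5 Prop. 5.1] -/
theorem hadd : ∀ v : HeightOneSpectrum ℤ,
    E.HasAdditiveReductionAt v → 3 < ringChar (ℤ ⧸ v.asIdeal) :=
  fun v h => (not_hasAdditiveReductionAt v h).elim

/-- **BGZ's sign as a theorem about the model**: under the named fact
`rootNumber_eq_algebraicRootNumber` alone, `w(5077a) = −1` (BGZ 1985 (10): `Λ(s) = −Λ(2 − s)`).
[cite: BuhlerGrossZagier1985, §3 eq. (10) (p. 478)] -/
theorem rootNumber_eq_neg_one (hRA : E.rootNumber_eq_algebraicRootNumber) : E.rootNumber = -1 :=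
  rootNumber_E_of_rootNumber_eq_algebraicRootNumber hRA hadd

/-- **`3 ≤ ord_{s=1} L(5077a, s)` from two named facts only** — Gross–Zagier–Kolyvagin (`hGZK`,
bsd.S17) and the root-number fact (`hRA`); the three independent points, the reduction types and
semistability are proved in the tree (BGZ 1985 p. 479; Cremona 1997 §2.13). This is the order-3
input of Goldfeld–Oesterlé's effective class-number bound `h(−d) > (1/55) log d`, `(d,5077) = 1`
(Gross–Zagier 1986 (8.2)). [cite: BuhlerGrossZagier1985, §4 p. 479] -/
theorem three_le_analyticRank_of_facts
    (hGZK : Literature.NumberTheory.EllipticCurves.rank_eq_analyticRank_of_analyticRank_le_one)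
    (hRA : E.rootNumber_eq_algebraicRootNumber) : 3 ≤ E.analyticRank :=
  three_le_analyticRank hGZK (rootNumber_eq_neg_one hRA)

/-- **`ord_{s=1} L(5077a, s) = 3`** from the two named facts and the certified upper bound
`ord ≤ 3` (`L‴(E,1)/3! = 1.7318499001193006897919750850601528…`, BGZ (14); hypothesis `h3`).
[cite: BuhlerGrossZagier1985, §4 eq. (14)] -/
theorem analyticRank_eq_three_of_facts
    (hGZK : Literature.NumberTheory.EllipticCurves.rank_eq_analyticRank_of_analyticRank_le_one)
    (hRA : E.rootNumber_eq_algebraicRootNumber) (h3 : E.analyticRank ≤ 3) : E.analyticRank = 3 :=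
  analyticRank_eq_three hGZK (rootNumber_eq_neg_one hRA) h3

end Literature.NumberTheory.EllipticCurves.Curve5077a
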